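import Literature.MathematicalPhysics.QuantumFieldTheory.Balaban1983to89.B11Eq127EulerLagrange

/-!
# `Balaban1983to89.B11Eq81Expansion` — T. Bałaban, *The variational problem and background fields in renormalization group method for lattice gauge theories*, Commun. Math. Phys. **102** (1985) 277–309 [Balaban1985Variational]: (74) p. 289 and (78)–(84) p. 290 — the expansion of the functional `𝔉(A′)` into zeroth, first, second and higher orders, `𝔉(A′) = A(U₀) + ⟨A′, J⟩ + ½⟨A′, Δ₁A′⟩ + V(A′)` (81), PROVED as an identity of abstract functionals, and the variational equation (82)–(84) with the full Fréchet derivative of (81) PROVED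

statement-level skeleton of published theorems with citation tags; proofs where landed; nothing here is a claim about the Yang–Mills mass gap

PDF held: `paper:balaban1985-cmp102-variational-background` (journal page = PDF page + 276).  Render
`run/shared/lean/pub/pub-balaban/b2b-balaban-ref1/pages/1985-cmp102-variational-background/…-p014-x2.png` (p. 290)
READ AS AN IMAGE by this seat (lit-balaban reader/typer r08, gen 2, 2026-08-21); (74) p. 289 from the render-verified
transcript `run/shared/lean/pub/pub-balaban/b2b-balaban-b11/transcript.md`.

CITATION HEADER (lean-in-tree rule 2026-08-18).  WHAT IS REPRODUCED: SKELETON rows `B11.Eq74` (the functional (74)),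
`B11.Eq78` ((78)–(81): `Δ₁`, `V`, the expansion of `𝔉`) and `B11.Eq82` ((82)–(84): the variational equation and the
derivative of (81)) of `HOME/lit-balaban-r08/ROWS-B11.md`, over the abstract real inner-product space vocabulary of
`B11Eq127EulerLagrange` (`functional81` = (81) is REUSED, not re-declared).  The termwise study of `(δ/δA′)V` that
follows ((85)–(96)) is `B11Eq85FirstDerivative` / `B11Eq93Commutator`; (127)–(128) are `B11Eq127EulerLagrange`.

THE PRINT (p. 289 [PDF 13] (74); p. 290 [PDF 14], verbatim).  «𝔉(A′) = A(U₀) + ⟨A′ − HD(A′), J⟩ + ½⟨A′ − HD(A′),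
Δ_π(A′ − HD(A′))⟩ + V₀(A′ − HD(A′)) (74)» … «Let us now decompose the functional 𝔉(A′) into a sum of terms of zeroth,
first, second and higher, orders in A′. The zeroth order term is A(U₀). Similarly, the first order term is the same as
before and equal to ⟨A′, J⟩. The expression ⟨HD(A′), J⟩ may be decomposed into terms of second and higher orders.
Taking into account that the second order term D^{(2)}(A′) in the expansion of D(A′) is equal to C^{(2)}(A′) =
C_j^{(2)}(LʲηA′) on Λ_j, we have
  ⟨HD(A′), J⟩ = ⟨HC^{(2)}(A′), J⟩ + ⟨HD₃(A′), J⟩. (78)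
Thus a quadratic form in the expansion of 𝔉(A′) is equal to
  ½⟨A′, Δ_πA′⟩ − ⟨HC^{(2)}(A′), J⟩ = ½⟨A′, Δ_πA′⟩ − ½⟨A′, Δ_π^{(2)}A′⟩ = ½⟨A′, Δ₁A′⟩, (79)
where we have used again the fact that A′ satisfy the Landau gauge condition RD*A′ = 0.
Now let us write higher order terms. They determine the functional
  V(A′) = −⟨HD₃(A′), J⟩ − ⟨A′, Δ_πHD(A′)⟩ + ½⟨HD(A′), Δ_πHD(A′)⟩ + V₀(A′ − HD(A′)). (80)
It is analytic in A′ for A′ with values in the complexified algebra and satisfying (77).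
We consider the functional
  𝔉(A′) = A(U₀) + ⟨A′, J⟩ + ½⟨A′, Δ₁A′⟩ + V(A′) (81)
on the space of configurations A′ satisfying (75)–(77). To find critical points of this functional we have to find A′
in the considered space, such that the equation
  ⟨(δ/δA′)𝔉(A′), δA′⟩ = 0 (82)
holds for all δA′ in the tangent space, that is δA′ satisfying the conditions
  QδA′ = 0, RD*δA′ = 0. (83)
We have to calculate the functional derivative of 𝔉(A′). From (81) we have
  ⟨(δ/δA′)𝔉(A′), δA′⟩ = ⟨δA′, J⟩ + ⟨δA′, Δ₁A′⟩ + ⟨(δ/δA′)V(A′), δA′⟩. (84)»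

DICTIONARY (abstract; nothing of the lattice is constructed).  `E` = fields `A′` with `⟨·,·⟩` (real inner-product
space); `A0 = A(U₀)`; `J` ((27)); `Δπ : E →ₗ[ℝ] E` symmetric = `Δ_π`; `HD : E → E` the composite nonlinear map
`A′ ↦ HD(A′)` of (47), split as `HD = HC2 + HD3` (`HC^{(2)}`, `HD₃`: hypothesis `hsplit`, = «D^{(2)}(A′) … is equal to
C^{(2)}(A′)» composed with the linear `H`); `Δπ2` = `Δ_π^{(2)}`, the symmetric operator DEFINED by `⟨HC^{(2)}(A′), J⟩ =
½⟨A′, Δ_π^{(2)}A′⟩` ([5] (3.127)–(3.128); hypothesis `h3127`); `V₀ : E → ℝ` ((31)/(39)); `Δ₁ = Δπ − Δπ2`.  The tangent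
space (83) is the submodule `ker Q ⊓ ker(RD*)` over abstract `Q`, `R`, `Dstar` (`tangent83`).  «the functional
derivative» of (82)/(84) is the Fréchet derivative (`HasFDerivAt`), paired with `δA′`.

WHAT IS CERTIFIED (kernel, sorry-free).  `functional74` = (74) (a `def` with body); **(78)** (`eq78`); **(79)** both
equalities (`eq79`); `V80` = (80) (a `def` with body); **(81)** THE EXPANSION IDENTITY `𝔉₍₇₄₎(A′) = A(U₀) + ⟨A′, J⟩ +
½⟨A′, (Δ_π − Δ_π^{(2)})A′⟩ + V(A′)` with `V = V80`, i.e. `functional74 … = B11Eq127EulerLagrange.functional81 A0 J (Δπ −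
Δπ2) (V80 …)` (`eq81`, using only the symmetry of `Δ_π`, the split `HD = HC^{(2)} + HD₃` and the defining property of
`Δ_π^{(2)}`); (83) as a submodule (`tangent83`, `mem_tangent83_iff`); (82) as the predicate `IsCritical82 dF T := ∀ δA′ ∈
T, dF δA′ = 0`; **(84)**: `functional81 c J Δ₁ V` has Fréchet derivative `δA′ ↦ ⟨δA′, J⟩ + ⟨δA′, Δ₁A′⟩ + DV δA′` at `A′`
for symmetric continuous `Δ₁` and `V` differentiable at `A′` (`hasFDerivAt84`, `hasFDerivAt84_apply`), so that (82) on
(83) reads `∀ δA′ ∈ T, ⟨δA′, J⟩ + ⟨δA′, Δ₁A′⟩ + DV δA′ = 0` (`isCritical82_iff`) — the shape concluded in (127)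
(`B11Eq127EulerLagrange.eq127`).

HONEST SCOPE — what is NOT claimed.  (i) «where we have used again the fact that A′ satisfy the Landau gauge condition
RD*A′ = 0»: in print the identification `⟨HC^{(2)}(A′), J⟩ = ½⟨A′, Δ_π^{(2)}A′⟩` holds on the gauge slice; here it is
the hypothesis `h3127` for the `A′` at hand, so no gauge condition appears.  (ii) The analyticity sentence after (80) and
the domain (75)–(77) are not typed here (`B11.Prop4Printed`, `B11GlobalMin.ChartCovers`).  (iii) `H`, `D`, `C^{(2)}`,
`D₃`, `Δ_π`, `Δ_π^{(2)}`, `J`, `V₀` are abstract data, not the lattice objects of [5]/[6]/Sects. B–C.  (iv) Nothing here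
is progress on the summit `Summit.QuantumFields`.  Unit `lit-balaban-r08` gen 2 (rows `B11.Eq74`, `B11.Eq78`, `B11.Eq82`
of `HOME/lit-balaban-r08/ROWS-B11.md`, HOME = `run/shared/lean/pub/lit-balaban/`).
-/

open scoped InnerProductSpace

namespace Literature.MathematicalPhysics.QuantumFieldTheory.Balaban1983to89.B11Eq81Expansion

open B11Eq127EulerLagrange (functional81)

variable {E : Type*} [NormedAddCommGroup E] [InnerProductSpace ℝ E]

/-! ## §1 (74), (78)–(81): the expansion of `𝔉` -/

/-- **(74)** `𝔉(A′) = A(U₀) + ⟨A′ − HD(A′), J⟩ + ½⟨A′ − HD(A′), Δ_π(A′ − HD(A′))⟩ + V₀(A′ − HD(A′))`, as a function of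
`A′` with the data `A0 = A(U₀)`, `J`, `Δπ`, the nonlinear map `HD` and `V₀`. [cite: Balaban1985Variational, (74) p.289] -/
noncomputable def functional74 (A0 : ℝ) (J : E) (Δπ : E →ₗ[ℝ] E) (HD : E → E) (V₀ : E → ℝ) (A : E) : ℝ :=
  A0 + ⟪A - HD A, J⟫_ℝ + 1 / 2 * ⟪A - HD A, Δπ (A - HD A)⟫_ℝ + V₀ (A - HD A)

/-- **(78)** `⟨HD(A′), J⟩ = ⟨HC^{(2)}(A′), J⟩ + ⟨HD₃(A′), J⟩` for the split `HD = HC^{(2)} + HD₃` («the second order term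
D^{(2)}(A′) in the expansion of D(A′) is equal to C^{(2)}(A′)»). [cite: Balaban1985Variational, (78) p.290] -/
theorem eq78 {HD HC2 HD3 : E → E} (hsplit : ∀ A, HD A = HC2 A + HD3 A) (J A : E) :
    ⟪HD A, J⟫_ℝ = ⟪HC2 A, J⟫_ℝ + ⟪HD3 A, J⟫_ℝ := by
  rw [hsplit A, inner_add_left]

/-- **(79)** `½⟨A′, Δ_πA′⟩ − ⟨HC^{(2)}(A′), J⟩ = ½⟨A′, Δ_πA′⟩ − ½⟨A′, Δ_π^{(2)}A′⟩ = ½⟨A′, Δ₁A′⟩`, `Δ₁ = Δ_π − Δ_π^{(2)}`,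
where `Δ_π^{(2)}` is the operator with `⟨HC^{(2)}(A′), J⟩ = ½⟨A′, Δ_π^{(2)}A′⟩` ([5] (3.127)–(3.128); hypothesis
`h3127`). [cite: Balaban1985Variational, (79) p.290] -/
theorem eq79 {Δπ Δπ2 : E →ₗ[ℝ] E} {HC2 : E → E} {J : E}
    (h3127 : ∀ A, ⟪HC2 A, J⟫_ℝ = 1 / 2 * ⟪A, Δπ2 A⟫_ℝ) (A : E) :
    (1 / 2 * ⟪A, Δπ A⟫_ℝ - ⟪HC2 A, J⟫_ℝ = 1 / 2 * ⟪A, Δπ A⟫_ℝ - 1 / 2 * ⟪A, Δπ2 A⟫_ℝ) ∧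
      (1 / 2 * ⟪A, Δπ A⟫_ℝ - 1 / 2 * ⟪A, Δπ2 A⟫_ℝ = 1 / 2 * ⟪A, (Δπ - Δπ2) A⟫_ℝ) := by
  refine ⟨by rw [h3127], ?_⟩
  rw [LinearMap.sub_apply, inner_sub_right]
  ring

/-- **(80)** «Now let us write higher order terms. They determine the functional
`V(A′) = −⟨HD₃(A′), J⟩ − ⟨A′, Δ_πHD(A′)⟩ + ½⟨HD(A′), Δ_πHD(A′)⟩ + V₀(A′ − HD(A′))`».
[cite: Balaban1985Variational, (80) p.290] -/
noncomputable def V80 (J : E) (Δπ : E →ₗ[ℝ] E) (HD HD3 : E → E) (V₀ : E → ℝ) (A : E) : ℝ :=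
  -⟪HD3 A, J⟫_ℝ - ⟪A, Δπ (HD A)⟫_ℝ + 1 / 2 * ⟪HD A, Δπ (HD A)⟫_ℝ + V₀ (A - HD A)

/-- **(81)** THE EXPANSION: for symmetric `Δ_π`, the split `HD = HC^{(2)} + HD₃` (78) and `⟨HC^{(2)}(A′), J⟩ =
½⟨A′, Δ_π^{(2)}A′⟩` (79), the functional (74) equals `A(U₀) + ⟨A′, J⟩ + ½⟨A′, Δ₁A′⟩ + V(A′)` with `Δ₁ = Δ_π − Δ_π^{(2)}`
and `V` = (80) — i.e. (74) IS the functional (81) of `B11Eq127EulerLagrange.functional81`.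
[cite: Balaban1985Variational, (81) p.290] -/
theorem eq81 (A0 : ℝ) (J : E) {Δπ Δπ2 : E →ₗ[ℝ] E} (hsymm : ∀ x y, ⟪Δπ x, y⟫_ℝ = ⟪x, Δπ y⟫_ℝ)
    {HD HC2 HD3 : E → E} (hsplit : ∀ A, HD A = HC2 A + HD3 A)
    (h3127 : ∀ A, ⟪HC2 A, J⟫_ℝ = 1 / 2 * ⟪A, Δπ2 A⟫_ℝ) (V₀ : E → ℝ) (A : E) :
    functional74 A0 J Δπ HD V₀ A = functional81 A0 J (Δπ - Δπ2) (V80 J Δπ HD HD3 V₀) A := by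
  have h1 : ⟪HD A, J⟫_ℝ = 1 / 2 * ⟪A, Δπ2 A⟫_ℝ + ⟪HD3 A, J⟫_ℝ := by
    rw [eq78 hsplit J A, h3127]
  have h2 : ⟪A, Δπ (HD A)⟫_ℝ = ⟪HD A, Δπ A⟫_ℝ := by
    rw [← hsymm (HD A) A]
    exact real_inner_comm _ _
  simp only [functional74, functional81, V80, LinearMap.sub_apply, map_sub, inner_sub_left, inner_sub_right]
  rw [h1, h2]
  ring

/-! ## §2 (82)–(84): the variational equation and the derivative of (81) -/

section Tangent

variable {F : Type*} [NormedAddCommGroup F] [InnerProductSpace ℝ F]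
variable {S : Type*} [AddCommGroup S] [Module ℝ S]

/-- **(83)** the tangent space `{δA′ : QδA′ = 0, RD*δA′ = 0}` as a submodule (`ker Q ⊓ ker RD*`).
[cite: Balaban1985Variational, (83) p.290] -/
def tangent83 (Q : E →ₗ[ℝ] F) (R : S →ₗ[ℝ] S) (Dstar : E →ₗ[ℝ] S) : Submodule ℝ E :=
  LinearMap.ker Q ⊓ LinearMap.ker (R ∘ₗ Dstar)

/-- Membership in (83): `δA′ ∈ T ↔ QδA′ = 0 ∧ RD*δA′ = 0`. [cite: Balaban1985Variational, (83) p.290] -/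
theorem mem_tangent83_iff (Q : E →ₗ[ℝ] F) (R : S →ₗ[ℝ] S) (Dstar : E →ₗ[ℝ] S) (δ : E) :
    δ ∈ tangent83 Q R Dstar ↔ Q δ = 0 ∧ R (Dstar δ) = 0 := by
  simp only [tangent83, Submodule.mem_inf, LinearMap.mem_ker, LinearMap.comp_apply]

end Tangent

/-- **(82)** «the equation ⟨(δ/δA′)𝔉(A′), δA′⟩ = 0 holds for all δA′ in the tangent space» — for the (Fréchet)
derivative `dF` of `𝔉` at `A′` and the tangent space `T` of (83). [cite: Balaban1985Variational, (82) p.290] -/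
def IsCritical82 (dF : E →L[ℝ] ℝ) (T : Submodule ℝ E) : Prop :=
  ∀ δ ∈ T, dF δ = 0

/-- **(84)** «From (81) we have ⟨(δ/δA′)𝔉(A′), δA′⟩ = ⟨δA′, J⟩ + ⟨δA′, Δ₁A′⟩ + ⟨(δ/δA′)V(A′), δA′⟩»: the functional (81)
(`functional81 c J Δ₁ V`) with `Δ₁` symmetric and continuous and `V` Fréchet-differentiable at `A′` with derivative `DV`
has Fréchet derivative `δA′ ↦ ⟨δA′, J⟩ + ⟨δA′, Δ₁A′⟩ + DV δA′` at `A′` («The functional derivatives above are calculated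
without any restrictions on variations»). [cite: Balaban1985Variational, (84) p.290] -/
theorem hasFDerivAt84 (c : ℝ) (J : E) (Δ₁ : E →L[ℝ] E) (hΔ : ∀ x y, ⟪Δ₁ x, y⟫_ℝ = ⟪x, Δ₁ y⟫_ℝ) {V : E → ℝ}
    {A : E} {DV : E →L[ℝ] ℝ} (hV : HasFDerivAt V DV A) :
    HasFDerivAt (functional81 c J (Δ₁ : E →ₗ[ℝ] E) V) (innerSL ℝ J + innerSL ℝ (Δ₁ A) + DV) A := by
  have hJ : HasFDerivAt (fun X : E => ⟪X, J⟫_ℝ) (innerSL ℝ J) A := by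
    have h := (innerSL ℝ J).hasFDerivAt (x := A)
    refine h.congr_of_eventuallyEq (Filter.Eventually.of_forall fun X => ?_)
    simp only [innerSL_apply_apply, real_inner_comm]
  have hQ : HasFDerivAt (fun X : E => 1 / 2 * ⟪X, Δ₁ X⟫_ℝ) (innerSL ℝ (Δ₁ A)) A := by
    refine (((hasFDerivAt_id A).inner ℝ (Δ₁.hasFDerivAt (x := A))).const_mul (1 / 2 : ℝ)).congr_fderiv ?_
    ext δ
    simp only [smul_apply, ContinuousLinearMap.comp_apply, ContinuousLinearMap.prod_apply,
      ContinuousLinearMap.id_apply, fderivInnerCLM_apply, innerSL_apply_apply, smul_eq_mul, id_eq]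
    rw [← hΔ A δ, real_inner_comm (Δ₁ A) δ]
    ring
  have h := (((hasFDerivAt_const c A).add hJ).add hQ).add hV
  rw [zero_add] at h
  refine h.congr_of_eventuallyEq (Filter.Eventually.of_forall fun X => ?_)
  simp only [functional81, ContinuousLinearMap.coe_coe, Pi.add_apply]

/-- (84) evaluated: the derivative applied to `δA′` is `⟨δA′, J⟩ + ⟨δA′, Δ₁A′⟩ + DV δA′` as printed.
[cite: Balaban1985Variational, (84) p.290] -/
theorem hasFDerivAt84_apply (J : E) (Δ₁ : E →L[ℝ] E) (DV : E →L[ℝ] ℝ) (A δ : E) :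
    (innerSL ℝ J + innerSL ℝ (Δ₁ A) + DV) δ = ⟪δ, J⟫_ℝ + ⟪δ, Δ₁ A⟫_ℝ + DV δ := by
  simp only [add_apply, innerSL_apply_apply, real_inner_comm]

/-- (82) for the functional (81), written out with (84): `A′` is critical on the tangent space `T` iff
`⟨δA′, J⟩ + ⟨δA′, Δ₁A′⟩ + DV δA′ = 0` for all `δA′ ∈ T` — the equation obtained in (127) from minimality
(`B11Eq127EulerLagrange.eq127`). [cite: Balaban1985Variational, (82)-(84) p.290] -/
theorem isCritical82_iff (J : E) (Δ₁ : E →L[ℝ] E) (DV : E →L[ℝ] ℝ) (A : E) (T : Submodule ℝ E) :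
    IsCritical82 (innerSL ℝ J + innerSL ℝ (Δ₁ A) + DV) T ↔
      ∀ δ ∈ T, ⟪δ, J⟫_ℝ + ⟪δ, Δ₁ A⟫_ℝ + DV δ = 0 := by
  simp only [IsCritical82, hasFDerivAt84_apply]

end Literature.MathematicalPhysics.QuantumFieldTheory.Balaban1983to89.B11Eq81Expansion
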